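import Literature.NumberTheory.Sieve.Maynard2016Lemma7ErrorFinal

/-!
# Maynard (2016), Lemma 7 — a finite probability model for the residue systems

J. Maynard, *Large gaps between primes*, Ann. of Math. 183 (2016), §6, proof of Lemma 7, displays
(6.27)–(6.29) and (6.32)–(6.33).

In the proof of Lemma 7 the main term of `Σ_{q ∈ 𝓘} (Σ_{d,e} λ_{d,e})²` is
`#𝓘 · Σ_{d,d',e,e'} λ_{d,e} λ_{d',e'} [system (6.27) solvable]/φ(r_{d,d',e,e'})` (`mainCoeff`,
`Maynard2016Lemma7ErrorSplit`).  This file rewrites such quadratic forms EXACTLY as second moments over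
the reduced residues modulo a squarefree modulus `R` (a multiple of every modulus in sight, e.g.
`R = primorial x`):

* `unitsR R` — the reduced residues `{u < R : (u, R) = 1}`, `#unitsR R = φ(R)` (`card_unitsR`);
* `sum_unitsR_mul_mod_eq` — **Chinese remainder theorem as an exact product formula**: for coprime
  `r, s`, `Σ_{u ∈ unitsR (r s)} g(u mod r) f(u mod s) = (Σ_{unitsR r} g)(Σ_{unitsR s} f)`;
  `card_unitsR_filter_mod_mul` — the fibre count `#{u ∈ unitsR R : u ≡ c (r)} · φ(r) = φ(R)` for
  `r ∣ R` squarefree and `(c, r) = 1`;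
* `card_unitsR_filter_linearSystem_mul` — for a squarefree linear system
  `D_t ∣ P_t + A_t u` (`t ∈ s`) as in `Maynard2016QSystemClass` with every `D_t ∣ R`:
  `#{u ∈ unitsR R : system(u)} · φ(rad ∏ D_t) = [system solvable] · φ(R)`;
* the Lemma-7 specialisation: `SysT` (the system of ONE pair `(d, e)`, so that the system of
  `(d,d',e,e')` is `SysT (d,e) ∧ SysT (d',e')`, `linearSystem_iff_sysT_and`), admissible weights
  `AdmWt` (on the support: squarefree coordinates, `d_j² < p₀`, `(m p₀ − 1, e_j) = 1` — e.g.
  `λ_{d,e}`), the random variable `Xwt Λ u = Σ_{d,e ∈ rbox} Λ_{d,e} [SysT (d,e) u]`, the quadratic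
  form `Qform Λ Λ' = Σ_{d,d',e,e' ∈ rbox} Λ_{d,e} Λ'_{d',e'} mainCoeff(1)` and the identity
  **`Qform Λ Λ' · φ(R) = Σ_{u ∈ unitsR R} Xwt Λ u · Xwt Λ' u`** (`Qform_mul_totient_eq_sum_unitsR`);
* `dvd_primorial_of_squarefree_le` — every squarefree `n ≤ x` divides `primorial x`.

This is the device by which the congruence-class correction of Lemma 7 (the sums restricted to
`q` in one class modulo a prime `w < p ≤ y`, display before (6.33)) is controlled downstream: in the
model the restriction is the event `u ≡ c (mod p)`, which is EXACTLY independent of `u mod R/p`.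

## References

* J. Maynard, *Large gaps between primes*, Ann. of Math. (2) 183 (2016), 915–933; arXiv:1408.5110,
  §6, proof of Lemma 7, displays (6.27)–(6.29), (6.32)–(6.33). [Maynard2016LargeGaps]
-/

noncomputable section

open Finset
open scoped BigOperators

namespace Literature.NumberTheory.Sieve

namespace Maynard2016

/-! ### Reduced residues and the Chinese remainder theorem -/

/-- The reduced residues modulo `R`: `{u < R : (R, u) = 1}` (the sample space of the finite model
for the residue classes of Lemma 7). [cite: Maynard2016LargeGaps, Lemma 7 (proof, displays (6.28)–(6.29))] -/
def unitsR (R : ℕ) : Finset ℕ := (Finset.range R).filter (fun u => Nat.Coprime R u)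

/-- Membership in `unitsR`. [cite: Maynard2016LargeGaps, Lemma 7 (proof, displays (6.28)–(6.29))] -/
theorem mem_unitsR {R u : ℕ} : u ∈ unitsR R ↔ u < R ∧ Nat.Coprime R u := by
  simp [unitsR]

/-- `#unitsR R = φ(R)`. [cite: Maynard2016LargeGaps, Lemma 7 (proof, displays (6.28)–(6.29))] -/
theorem card_unitsR (R : ℕ) : (unitsR R).card = Nat.totient R :=
  (Nat.totient_eq_card_coprime R).symm

/-- `(r, u mod r) = 1 ↔ (r, u) = 1`. [cite: Maynard2016LargeGaps, Lemma 7 (proof, displays (6.28)–(6.29))] -/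
theorem coprime_mod_iff {r u : ℕ} : Nat.Coprime r (u % r) ↔ Nat.Coprime r u := by
  unfold Nat.Coprime
  rw [Nat.gcd_comm r (u % r), ← Nat.gcd_rec]

/-- **Chinese remainder theorem, product form**: for coprime `r, s ≠ 0` the map
`u ↦ (u mod r, u mod s)` is a bijection `unitsR (r s) → unitsR r × unitsR s`, so that
`Σ_{u ∈ unitsR (r s)} g(u mod r) f(u mod s) = (Σ_{unitsR r} g) (Σ_{unitsR s} f)` (the exact
independence of the residues modulo coprime moduli behind "q lies in a single residue class").
[cite: Maynard2016LargeGaps, Lemma 7 (proof, displays (6.28)–(6.29))] -/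
theorem sum_unitsR_mul_mod_eq {α : Type*} [CommSemiring α] {r s : ℕ} (hr : r ≠ 0) (hs : s ≠ 0)
    (hrs : r.Coprime s) (g f : ℕ → α) :
    ∑ u ∈ unitsR (r * s), g (u % r) * f (u % s) =
      (∑ a ∈ unitsR r, g a) * ∑ b ∈ unitsR s, f b := by
  rw [Finset.sum_mul_sum, ← Finset.sum_product']
  refine Finset.sum_nbij' (fun u => (u % r, u % s))
    (fun ab => (Nat.chineseRemainder hrs ab.1 ab.2 : ℕ)) ?_ ?_ ?_ ?_ ?_
  · intro u hu
    rw [mem_unitsR] at hu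
    obtain ⟨h1, h2⟩ := Nat.coprime_mul_iff_left.1 hu.2
    simp only [Finset.mem_product, mem_unitsR]
    exact ⟨⟨Nat.mod_lt _ (Nat.pos_of_ne_zero hr), coprime_mod_iff.2 h1⟩,
      ⟨Nat.mod_lt _ (Nat.pos_of_ne_zero hs), coprime_mod_iff.2 h2⟩⟩
  · rintro ⟨a, b⟩ hab
    simp only [Finset.mem_product, mem_unitsR] at hab
    rw [mem_unitsR]
    have h1 : (Nat.chineseRemainder hrs a b : ℕ) % r = a := by
      have h := (Nat.chineseRemainder hrs a b).prop.1
      unfold Nat.ModEq at h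
      rw [h, Nat.mod_eq_of_lt hab.1.1]
    have h2 : (Nat.chineseRemainder hrs a b : ℕ) % s = b := by
      have h := (Nat.chineseRemainder hrs a b).prop.2
      unfold Nat.ModEq at h
      rw [h, Nat.mod_eq_of_lt hab.2.1]
    refine ⟨Nat.chineseRemainder_lt_mul hrs a b hr hs, Nat.Coprime.mul_left ?_ ?_⟩
    · rw [← coprime_mod_iff, h1]; exact hab.1.2
    · rw [← coprime_mod_iff, h2]; exact hab.2.2
  · intro u hu
    rw [mem_unitsR] at hu
    have hmod := Nat.chineseRemainder_modEq_unique hrs (a := u % r) (b := u % s) (z := u)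
      (Nat.mod_modEq _ _).symm (Nat.mod_modEq _ _).symm
    exact (Nat.ModEq.eq_of_lt_of_lt hmod hu.1 (Nat.chineseRemainder_lt_mul hrs _ _ hr hs)).symm
  · rintro ⟨a, b⟩ hab
    simp only [Finset.mem_product, mem_unitsR] at hab
    have h1 : (Nat.chineseRemainder hrs a b : ℕ) % r = a := by
      have h := (Nat.chineseRemainder hrs a b).prop.1
      unfold Nat.ModEq at h
      rw [h, Nat.mod_eq_of_lt hab.1.1]
    have h2 : (Nat.chineseRemainder hrs a b : ℕ) % s = b := by
      have h := (Nat.chineseRemainder hrs a b).prop.2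
      unfold Nat.ModEq at h
      rw [h, Nat.mod_eq_of_lt hab.2.1]
    simp only [h1, h2]
  · intro u _
    rfl

/-- **Fibre count**: for `R` squarefree, `r ∣ R` and `(r, c) = 1`,
`#{u ∈ unitsR R : u ≡ c (mod r)} · φ(r) = φ(R)` (the density `1/φ(r)` of display (6.29)).
[cite: Maynard2016LargeGaps, Lemma 7 (proof, displays (6.28)–(6.29))] -/
theorem card_unitsR_filter_mod_mul {R r c : ℕ} (hR : Squarefree R) (hrR : r ∣ R)
    (hc : Nat.Coprime r c) :
    ((unitsR R).filter (fun u => u % r = c % r)).card * Nat.totient r = Nat.totient R := by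
  classical
  obtain ⟨s, rfl⟩ := hrR
  have hr : r ≠ 0 := fun h => by simp [h] at hR
  have hs : s ≠ 0 := fun h => by simp [h] at hR
  have hrs : r.Coprime s := Nat.coprime_of_squarefree_mul hR
  have key := sum_unitsR_mul_mod_eq hr hs hrs (fun a => if a = c % r then (1 : ℕ) else 0)
    (fun _ => (1 : ℕ))
  have hmem : c % r ∈ unitsR r :=
    mem_unitsR.2 ⟨Nat.mod_lt _ (Nat.pos_of_ne_zero hr), coprime_mod_iff.2 hc⟩
  have h1 : ∑ u ∈ unitsR (r * s), (if u % r = c % r then (1 : ℕ) else 0) * 1 =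
      ((unitsR (r * s)).filter (fun u => u % r = c % r)).card := by
    simp only [mul_one, Finset.sum_boole, Nat.cast_id]
  have h2 : ∑ a ∈ unitsR r, (if a = c % r then (1 : ℕ) else 0) = 1 := by
    rw [Finset.sum_ite_eq' (unitsR r) (c % r) (fun _ => (1 : ℕ)), if_pos hmem]
  have h3 : ∑ b ∈ unitsR s, (fun _ => (1 : ℕ)) b = Nat.totient s := by
    simp [card_unitsR]
  rw [h1, h2, h3, one_mul] at key
  rw [key, Nat.totient_mul hrs, mul_comm]

/-! ### Counting the solutions of a squarefree linear system among the reduced residues -/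

/-- The radical `∏_{p ∣ ∏ D_t} p` divides every squarefree common multiple `R` of the `D_t`.
[cite: Maynard2016LargeGaps, Lemma 7 (proof, p. 12)] -/
theorem prod_primeFactors_dvd_of_forall_dvd {ι : Type*} (s : Finset ι) (D : ι → ℕ) {R : ℕ}
    (hR : Squarefree R) (hDR : ∀ t ∈ s, D t ∣ R) :
    ∏ p ∈ (∏ t ∈ s, D t).primeFactors, p ∣ R := by
  classical
  have hsub : (∏ t ∈ s, D t).primeFactors ⊆ R.primeFactors := by
    intro p hp
    rw [Nat.mem_primeFactors] at hp ⊢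
    obtain ⟨t, ht, hpt⟩ := (Prime.dvd_finsetProd_iff hp.1.prime _).1 hp.2.1
    exact ⟨hp.1, hpt.trans (hDR t ht), hR.ne_zero⟩
  calc ∏ p ∈ (∏ t ∈ s, D t).primeFactors, p ∣ ∏ p ∈ R.primeFactors, p :=
        Finset.prod_dvd_prod_of_subset _ _ _ hsub
    _ = R := Nat.prod_primeFactors_of_squarefree hR

open Classical in
/-- **Solutions of a squarefree linear system among the reduced residues.**  Under the hypotheses
of `linearSystem_empty_or_coprime_class` (squarefree moduli `D_t ∣ R`, unit coefficients, constant
terms prime to the moduli), `#{u ∈ unitsR R : ∀ t, D_t ∣ P_t + A_t u} · φ(rad ∏ D_t)` equals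
`φ(R)` if the system has a solution and `0` otherwise ("the density of the class is `1/φ(r)`").
[cite: Maynard2016LargeGaps, Lemma 7 (proof, displays (6.28)–(6.29))] -/
theorem card_unitsR_filter_linearSystem_mul {ι : Type*} (s : Finset ι) (D : ι → ℕ) (P A : ι → ℤ)
    (hsq : ∀ t ∈ s, Squarefree (D t))
    (hunit : ∀ t ∈ s, ∀ q : ℕ, (D t : ℤ) ∣ P t + A t * q → IsCoprime (A t) (D t : ℤ))
    (hP : ∀ t ∈ s, ∀ p : ℕ, p.Prime → p ∣ D t → ¬ (p : ℤ) ∣ P t)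
    {R : ℕ} (hR : Squarefree R) (hDR : ∀ t ∈ s, D t ∣ R) :
    ((((unitsR R).filter (fun u : ℕ => ∀ t ∈ s, (D t : ℤ) ∣ P t + A t * (u : ℤ))).card : ℕ) : ℝ) *
        (Nat.totient (∏ p ∈ (∏ t ∈ s, D t).primeFactors, p) : ℝ) =
      if ∃ u : ℕ, ∀ t ∈ s, (D t : ℤ) ∣ P t + A t * (u : ℤ) then (Nat.totient R : ℝ) else 0 := by
  rcases linearSystem_empty_or_coprime_class s D P A hsq hunit hP with hnone | ⟨c, hc, hcop, hiff⟩
  · rw [if_neg (fun ⟨u, hu⟩ => hnone u hu)]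
    have hfil : (unitsR R).filter (fun u : ℕ => ∀ t ∈ s, (D t : ℤ) ∣ P t + A t * (u : ℤ)) = ∅ :=
      Finset.filter_eq_empty_iff.2 fun u _ => hnone u
    rw [hfil, Finset.card_empty, Nat.cast_zero, zero_mul]
  · set rad : ℕ := ∏ p ∈ (∏ t ∈ s, D t).primeFactors, p with hrad
    rw [if_pos ⟨c, (hiff c).2 (Nat.mod_eq_of_lt hc)⟩]
    have hfil : (unitsR R).filter (fun u : ℕ => ∀ t ∈ s, (D t : ℤ) ∣ P t + A t * (u : ℤ)) =
        (unitsR R).filter (fun u => u % rad = c % rad) :=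
      Finset.filter_congr fun u _ => by rw [hiff u, Nat.mod_eq_of_lt hc]
    rw [hfil]
    have hradR : rad ∣ R := prod_primeFactors_dvd_of_forall_dvd s D hR hDR
    exact_mod_cast card_unitsR_filter_mod_mul hR hradR hcop.symm

/-! ### The Lemma-7 systems: one pair `(d, e)` at a time -/

variable {k : ℕ}

/-- The moduli of the system of ONE pair `(d, e)`: `d_j` on the `d`-side, `e_j` on the `e`-side.
[cite: Maynard2016LargeGaps, Lemma 7 (proof, display (6.27))] -/
def sysD₁ (d e : Fin k → ℕ) : Fin k ⊕ Fin k → ℕ := Sum.elim d e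

/-- The system of ONE pair `(d, e)` at the integer `u` (playing the role of `q`):
`d_j ∣ p₀ + (h_j − h_i) u` and `e_j ∣ (m p₀ − 1) + m (h_j − h_i) u` for all `j`.
[cite: Maynard2016LargeGaps, Lemma 7 (proof, display (6.27))] -/
def SysT (k x m p₀ : ℕ) (i : Fin k) (d e : Fin k → ℕ) (u : ℕ) : Prop :=
  ∀ t : Fin k ⊕ Fin k, (sysD₁ d e t : ℤ) ∣ sysP k m p₀ t + sysA k x i m t * (u : ℤ)

/-- The moduli of the system of `(d,d',e,e')` are the lcm's of the one-pair moduli.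
[cite: Maynard2016LargeGaps, Lemma 7 (proof, display (6.27))] -/
theorem sysD_eq_lcm (d d' e e' : Fin k → ℕ) (t : Fin k ⊕ Fin k) :
    sysD d d' e e' t = Nat.lcm (sysD₁ d e t) (sysD₁ d' e' t) := by
  cases t <;> rfl

/-- **The system of `(d,d',e,e')` is the conjunction of the one-pair systems of `(d,e)` and
`(d',e')`.** [cite: Maynard2016LargeGaps, Lemma 7 (proof, display (6.27))] -/
theorem linearSystem_iff_sysT_and {x m p₀ : ℕ} {i : Fin k} (d d' e e' : Fin k → ℕ) (u : ℕ) :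
    (∀ t ∈ (Finset.univ : Finset (Fin k ⊕ Fin k)),
        (sysD d d' e e' t : ℤ) ∣ sysP k m p₀ t + sysA k x i m t * (u : ℤ)) ↔
      SysT k x m p₀ i d e u ∧ SysT k x m p₀ i d' e' u := by
  -- `[a,b] ∣ z ↔ a ∣ z ∧ b ∣ z` is `Literature.NumberTheory.Sieve.natCast_lcm_dvd_iff`; inlined here
  simp only [Finset.mem_univ, true_implies, SysT, sysD_eq_lcm, Int.natCast_dvd, Nat.lcm_dvd_iff,
    forall_and]

/-- **Admissible weights**: on the support of `Λ` the coordinates are squarefree, `d_j² < p₀` and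
`(m p₀ − 1, e_j) = 1` (for `Λ = λ` this is `support_hyps_of_lam_ne_zero`; the class is stable under
the coordinate operations `d_j ↦ p d_j` used downstream). [cite: Maynard2016LargeGaps, Lemma 7 (proof, (6.26)–(6.27))] -/
def AdmWt (k m p₀ : ℕ) (Λ : (Fin k → ℕ) → (Fin k → ℕ) → ℝ) : Prop :=
  ∀ d e, Λ d e ≠ 0 → (∀ j, Squarefree (d j)) ∧ (∀ j, Squarefree (e j)) ∧
    (∀ j, d j * d j < p₀) ∧ ∀ j, Nat.Coprime (m * p₀ - 1) (e j)

/-- The pair hypotheses of `abs_card_filter_system_sub_mainCoeff_le` hold on the support of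
`Λ ⊗ Λ'` for admissible weights. [cite: Maynard2016LargeGaps, Lemma 7 (proof, (6.26)–(6.27))] -/
theorem AdmWt.pair_hyps {m p₀ : ℕ} {Λ Λ' : (Fin k → ℕ) → (Fin k → ℕ) → ℝ} (hΛ : AdmWt k m p₀ Λ)
    (hΛ' : AdmWt k m p₀ Λ') {d d' e e' : Fin k → ℕ} (h : Λ d e ≠ 0) (h' : Λ' d' e' ≠ 0) :
    (∀ j, Squarefree (d j)) ∧ (∀ j, Squarefree (d' j)) ∧ (∀ j, Squarefree (e j)) ∧
      (∀ j, Squarefree (e' j)) ∧ (∀ j, d j * d' j < p₀) ∧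
      (∀ j, Nat.Coprime (m * p₀ - 1) (e j * e' j)) := by
  obtain ⟨hd, he, hdd, hec⟩ := hΛ d e h
  obtain ⟨hd', he', hdd', hec'⟩ := hΛ' d' e' h'
  refine ⟨hd, hd', he, he', fun j => ?_, fun j => Nat.Coprime.mul_right (hec j) (hec' j)⟩
  have h1 := hdd j
  have h2 := hdd' j
  by_contra hle
  push Not at hle
  have : p₀ * p₀ ≤ (d j * d' j) * (d j * d' j) := Nat.mul_le_mul hle hle
  nlinarith

open Classical in
/-- **The random variable of a weight**: `X_Λ(u) = Σ_{d,e ∈ rbox} Λ_{d,e} [SysT (d,e) u]`.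
[cite: Maynard2016LargeGaps, Lemma 7 (proof, display (6.32))] -/
def Xwt (k x m p₀ : ℕ) (i : Fin k) (Λ : (Fin k → ℕ) → (Fin k → ℕ) → ℝ) (u : ℕ) : ℝ :=
  ∑ d ∈ rbox k x i, ∑ e ∈ rbox k x i, if SysT k x m p₀ i d e u then Λ d e else 0

/-- **The quadratic form of the main term**:
`Q(Λ, Λ') = Σ_{d,d',e,e' ∈ rbox} Λ_{d,e} Λ'_{d',e'} mainCoeff(1)` (for `Λ = Λ' = λ` this is
`solvSum`). [cite: Maynard2016LargeGaps, Lemma 7 (proof, displays (6.29), (6.32))] -/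
def Qform (k x m p₀ : ℕ) (i : Fin k) (Λ Λ' : (Fin k → ℕ) → (Fin k → ℕ) → ℝ) : ℝ :=
  ∑ d ∈ rbox k x i, ∑ d' ∈ rbox k x i, ∑ e ∈ rbox k x i, ∑ e' ∈ rbox k x i,
    Λ d e * Λ' d' e' * mainCoeff k x m p₀ i d d' e e' 1

/-- `solvSum = Q(λ, λ)`. [cite: Maynard2016LargeGaps, Lemma 7 (proof, display (6.29))] -/
theorem solvSum_eq_Qform {J : ℕ} (c : Fin J → ℝ) (Fd : Fin k → Fin J → ℝ → ℝ) (G : ℝ → ℝ)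
    (ε : ℝ) (x m p₀ : ℕ) (i : Fin k) :
    solvSum c Fd G ε x m p₀ i = Qform k x m p₀ i (lam c Fd G ε x) (lam c Fd G ε x) := by
  classical
  unfold solvSum Qform mainCoeff
  refine Finset.sum_congr rfl fun d _ => Finset.sum_congr rfl fun d' _ =>
    Finset.sum_congr rfl fun e _ => Finset.sum_congr rfl fun e' _ => ?_
  split_ifs <;> simp [div_eq_mul_inv]

/-- Every squarefree `n ≤ x` divides `primorial x` (so `R = primorial x` is an admissible modulus
for the model). [cite: Maynard2016LargeGaps, Lemma 7 (proof, displays (6.28)–(6.29))] -/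
theorem dvd_primorial_of_squarefree_le {n x : ℕ} (hn : Squarefree n) (hnx : n ≤ x) :
    n ∣ primorial x :=
  hn.dvd_primorial.trans (primorial_dvd_primorial hnx)

open Classical in
/-- **Per tuple**: `Λ_{d,e} Λ'_{d',e'} mainCoeff(1) · φ(R) = Σ_{u ∈ unitsR R} Λ[SysT(d,e) u] Λ'[SysT(d',e') u]`
for admissible weights, `R` squarefree and every squarefree `n ≤ x` dividing `R`.
[cite: Maynard2016LargeGaps, Lemma 7 (proof, displays (6.28)–(6.29))] -/
theorem mul_mainCoeff_mul_totient_eq_sum_unitsR {x m p₀ : ℕ} (hp₀ : p₀.Prime) (hm : 1 ≤ m)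
    {i : Fin k}
    (hacop : ∀ j, j ≠ i → IsCoprime ((m : ℤ) * p₀ - 1) ((hTuple k x j : ℤ) - hTuple k x i))
    {Λ Λ' : (Fin k → ℕ) → (Fin k → ℕ) → ℝ} (hΛ : AdmWt k m p₀ Λ) (hΛ' : AdmWt k m p₀ Λ')
    {R : ℕ} (hR : Squarefree R) (hxR : ∀ n, Squarefree n → n ≤ x → n ∣ R)
    {d d' e e' : Fin k → ℕ} (hd : d ∈ rbox k x i) (hd' : d' ∈ rbox k x i) (he : e ∈ rbox k x i)
    (he' : e' ∈ rbox k x i) :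
    Λ d e * Λ' d' e' * mainCoeff k x m p₀ i d d' e e' 1 * (Nat.totient R : ℝ) =
      ∑ u ∈ unitsR R, (if SysT k x m p₀ i d e u then Λ d e else 0) *
        (if SysT k x m p₀ i d' e' u then Λ' d' e' else 0) := by
  -- the right-hand side is `ΛΛ' · #{u : both systems}`
  have hrhs : ∑ u ∈ unitsR R, (if SysT k x m p₀ i d e u then Λ d e else 0) *
        (if SysT k x m p₀ i d' e' u then Λ' d' e' else 0) =
      Λ d e * Λ' d' e' * (((unitsR R).filter (fun u : ℕ => ∀ t ∈ (Finset.univ : Finset (Fin k ⊕ Fin k)),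
        (sysD d d' e e' t : ℤ) ∣ sysP k m p₀ t + sysA k x i m t * (u : ℤ))).card : ℝ) := by
    have hfil : (unitsR R).filter (fun u : ℕ => ∀ t ∈ (Finset.univ : Finset (Fin k ⊕ Fin k)),
        (sysD d d' e e' t : ℤ) ∣ sysP k m p₀ t + sysA k x i m t * (u : ℤ)) =
        (unitsR R).filter (fun u => SysT k x m p₀ i d e u ∧ SysT k x m p₀ i d' e' u) :=
      Finset.filter_congr fun u _ => linearSystem_iff_sysT_and d d' e e' u
    rw [hfil]
    have : ∀ u, (if SysT k x m p₀ i d e u then Λ d e else 0) *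
        (if SysT k x m p₀ i d' e' u then Λ' d' e' else 0) =
        if SysT k x m p₀ i d e u ∧ SysT k x m p₀ i d' e' u then Λ d e * Λ' d' e' else 0 := by
      intro u
      split_ifs <;> simp_all
    simp_rw [this]
    rw [Finset.sum_ite, Finset.sum_const_zero, add_zero, Finset.sum_const, nsmul_eq_mul, mul_comm]
  rw [hrhs]
  by_cases hz : Λ d e = 0
  · simp [hz]
  by_cases hz' : Λ' d' e' = 0
  · simp [hz']
  -- on the support: the hypotheses of the class lemma
  obtain ⟨hsd, hsd', hse, hse', hdlt, hecop⟩ := hΛ.pair_hyps hΛ' hz hz'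
  have hei : e i = 1 := (mem_rbox.1 he).2
  have hei' : e' i = 1 := (mem_rbox.1 he').2
  have hd0 : ∀ j, d j ≠ 0 := fun j => (hsd j).ne_zero
  have hd0' : ∀ j, d' j ≠ 0 := fun j => (hsd' j).ne_zero
  -- every modulus divides `R`
  have hcoord : ∀ {f : Fin k → ℕ}, f ∈ rbox k x i → (∀ j, Squarefree (f j)) → ∀ j, f j ∣ R := by
    intro f hf hsq j
    have hfb := (mem_rbox.1 hf).1
    have hle : f j ≤ x := (Finset.mem_Icc.1 (Fintype.mem_piFinset.1 hfb j)).2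
    exact hxR _ (hsq j) hle
  have hDR : ∀ t ∈ (Finset.univ : Finset (Fin k ⊕ Fin k)), sysD d d' e e' t ∣ R := by
    rintro (j | j) -
    · exact Nat.lcm_dvd (hcoord hd hsd j) (hcoord hd' hsd' j)
    · exact Nat.lcm_dvd (hcoord he hse j) (hcoord he' hse' j)
  have key := card_unitsR_filter_linearSystem_mul (Finset.univ : Finset (Fin k ⊕ Fin k))
    (sysD d d' e e') (sysP k m p₀) (sysA k x i m) (sys_squarefree hsd hsd' hse hse')
    (sys_unit hp₀ hd0 hd0' hdlt hei hei' hacop) (sys_constant_coprime hp₀ hm hd0 hd0' hdlt hecop)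
    hR hDR
  -- compare with `mainCoeff` (the `convert` absorbs the decidability instances)
  have hrad0 : (0 : ℝ) < (Nat.totient (radMod d d' e e') : ℝ) := by
    exact_mod_cast Nat.totient_pos.2 (radMod_pos d d' e e')
  have key' : ((((unitsR R).filter (fun u : ℕ => ∀ t ∈ (Finset.univ : Finset (Fin k ⊕ Fin k)),
        (sysD d d' e e' t : ℤ) ∣ sysP k m p₀ t + sysA k x i m t * (u : ℤ))).card : ℕ) : ℝ) *
        (Nat.totient (radMod d d' e e') : ℝ) =
      if SysSolvable k x m p₀ i d d' e e' then (Nat.totient R : ℝ) else 0 := by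
    convert key using 6 <;> rfl
  unfold mainCoeff
  by_cases hsol : SysSolvable k x m p₀ i d d' e e'
  · rw [if_pos hsol]
    rw [if_pos hsol] at key'
    have hcard : ((((unitsR R).filter (fun u : ℕ => ∀ t ∈ (Finset.univ : Finset (Fin k ⊕ Fin k)),
        (sysD d d' e e' t : ℤ) ∣ sysP k m p₀ t + sysA k x i m t * (u : ℤ))).card : ℕ) : ℝ) =
        (Nat.totient R : ℝ) / (Nat.totient (radMod d d' e e') : ℝ) := by
      rw [eq_div_iff hrad0.ne', key']
    rw [hcard]
    ring
  · rw [if_neg hsol]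
    rw [if_neg hsol] at key'
    have hcard : ((((unitsR R).filter (fun u : ℕ => ∀ t ∈ (Finset.univ : Finset (Fin k ⊕ Fin k)),
        (sysD d d' e e' t : ℤ) ∣ sysP k m p₀ t + sysA k x i m t * (u : ℤ))).card : ℕ) : ℝ) = 0 := by
      rcases mul_eq_zero.1 key' with h | h
      · exact h
      · exact absurd h hrad0.ne'
    rw [hcard]
    ring

open Classical in
/-- **The main-term quadratic form is a second moment**: for admissible weights `Λ, Λ'`,
`R` squarefree and every squarefree `n ≤ x` dividing `R` (e.g. `R = primorial x`),
`Q(Λ, Λ') · φ(R) = Σ_{u ∈ unitsR R} X_Λ(u) X_{Λ'}(u)`.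
[cite: Maynard2016LargeGaps, Lemma 7 (proof, displays (6.29), (6.32))] -/
theorem Qform_mul_totient_eq_sum_unitsR {x m p₀ : ℕ} (hp₀ : p₀.Prime) (hm : 1 ≤ m) {i : Fin k}
    (hacop : ∀ j, j ≠ i → IsCoprime ((m : ℤ) * p₀ - 1) ((hTuple k x j : ℤ) - hTuple k x i))
    {Λ Λ' : (Fin k → ℕ) → (Fin k → ℕ) → ℝ} (hΛ : AdmWt k m p₀ Λ) (hΛ' : AdmWt k m p₀ Λ')
    {R : ℕ} (hR : Squarefree R) (hxR : ∀ n, Squarefree n → n ≤ x → n ∣ R) :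
    Qform k x m p₀ i Λ Λ' * (Nat.totient R : ℝ) =
      ∑ u ∈ unitsR R, Xwt k x m p₀ i Λ u * Xwt k x m p₀ i Λ' u := by
  -- expand the right-hand side: `X X' = Σ_d Σ_{d'} Σ_e Σ_{e'} (…)(…)`
  have hrhs : ∀ u, Xwt k x m p₀ i Λ u * Xwt k x m p₀ i Λ' u =
      ∑ d ∈ rbox k x i, ∑ d' ∈ rbox k x i, ∑ e ∈ rbox k x i, ∑ e' ∈ rbox k x i,
        (if SysT k x m p₀ i d e u then Λ d e else 0) *
          (if SysT k x m p₀ i d' e' u then Λ' d' e' else 0) := by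
    intro u
    unfold Xwt
    rw [Finset.sum_mul_sum]
    refine Finset.sum_congr rfl fun d _ => Finset.sum_congr rfl fun d' _ => ?_
    rw [Finset.sum_mul_sum]
  simp only [hrhs]
  unfold Qform
  rw [Finset.sum_mul, Finset.sum_comm]
  refine Finset.sum_congr rfl fun d hd => ?_
  rw [Finset.sum_mul, Finset.sum_comm]
  refine Finset.sum_congr rfl fun d' hd' => ?_
  rw [Finset.sum_mul, Finset.sum_comm]
  refine Finset.sum_congr rfl fun e he => ?_
  rw [Finset.sum_mul, Finset.sum_comm]
  refine Finset.sum_congr rfl fun e' he' => ?_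
  exact mul_mainCoeff_mul_totient_eq_sum_unitsR hp₀ hm hacop hΛ hΛ' hR hxR hd hd' he he'

/-- **The GPY weights are admissible** (on the support of `λ_{d,e} λ_{d,e}`: squarefree
coordinates, `d_j² < p₀`, `(m p₀ − 1, e_j) = 1`), for `1 ≤ x < p₀` and `(m p₀ − 1, P_y) = 1`.
[cite: Maynard2016LargeGaps, Lemma 7 (proof, (6.26)–(6.27))] -/
theorem admWt_lam {J : ℕ} {c : Fin J → ℝ} {Fd : Fin k → Fin J → ℝ → ℝ} {G : ℝ → ℝ}
    (hD : IsSieveData k J c Fd G) {ε : ℝ} {x : ℕ} (hx1 : 1 ≤ x) (hlogx : 0 < Real.log x)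
    (hlogy : 0 < Real.log (y ε x)) {m p₀ : ℕ} (hxp : x < p₀)
    (hcop : Nat.Coprime (m * p₀ - 1) (primorial ⌊y ε x⌋₊)) (i : Fin k) :
    AdmWt k m p₀ (fun d e => if d ∈ rbox k x i ∧ e ∈ rbox k x i then lam c Fd G ε x d e else 0) := by
  intro d e h
  dsimp only at h
  by_cases hde : d ∈ rbox k x i ∧ e ∈ rbox k x i
  · rw [if_pos hde] at h
    have hdb := (mem_rbox.1 hde.1).1
    have heb := (mem_rbox.1 hde.2).1
    obtain ⟨hsd, -, hse, -, hdlt, hecop⟩ :=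
      support_hyps_of_lam_ne_zero hD hx1 hlogx hlogy hxp hcop hdb hdb heb heb h h
    exact ⟨hsd, hse, hdlt, fun j => Nat.Coprime.coprime_dvd_right (dvd_mul_right (e j) (e j)) (hecop j)⟩
  · rw [if_neg hde] at h
    exact absurd rfl h

/-- `Q` only sees the values of the weights on `rbox × rbox`. [cite: Maynard2016LargeGaps, Lemma 7 (proof, display (6.29))] -/
theorem Qform_restrict (k x m p₀ : ℕ) (i : Fin k) (Λ Λ' : (Fin k → ℕ) → (Fin k → ℕ) → ℝ) :
    Qform k x m p₀ i (fun d e => if d ∈ rbox k x i ∧ e ∈ rbox k x i then Λ d e else 0)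
        (fun d e => if d ∈ rbox k x i ∧ e ∈ rbox k x i then Λ' d e else 0) =
      Qform k x m p₀ i Λ Λ' := by
  unfold Qform
  refine Finset.sum_congr rfl fun d hd => Finset.sum_congr rfl fun d' hd' =>
    Finset.sum_congr rfl fun e he => Finset.sum_congr rfl fun e' he' => ?_
  dsimp only
  rw [if_pos (show d ∈ rbox k x i ∧ e ∈ rbox k x i from ⟨hd, he⟩),
    if_pos (show d' ∈ rbox k x i ∧ e' ∈ rbox k x i from ⟨hd', he'⟩)]

open Classical in
/-- `X` only sees the values of the weight on `rbox × rbox`. [cite: Maynard2016LargeGaps, Lemma 7 (proof, display (6.32))] -/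
theorem Xwt_restrict (k x m p₀ : ℕ) (i : Fin k) (Λ : (Fin k → ℕ) → (Fin k → ℕ) → ℝ) (u : ℕ) :
    Xwt k x m p₀ i (fun d e => if d ∈ rbox k x i ∧ e ∈ rbox k x i then Λ d e else 0) u =
      Xwt k x m p₀ i Λ u := by
  unfold Xwt
  refine Finset.sum_congr rfl fun d hd => Finset.sum_congr rfl fun e he => ?_
  dsimp only
  rw [if_pos (show d ∈ rbox k x i ∧ e ∈ rbox k x i from ⟨hd, he⟩)]

end Maynard2016

end Literature.NumberTheory.Sieve
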